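import Summits.ResolutionOfSingularities.ResolutionOfSingularities.Theorems.FrobeniusLadderFRationalResolutionFixedPointLogRegular
import Summits.ResolutionOfSingularities.ResolutionOfSingularities.Theorems.FrobeniusLadderFRationalResolutionHomogeneousUnits
import Literature.AlgebraicGeometry.Resolution.LogRegularResolution
import HarnessLib

/-!
# Crux `FrobeniusLadder.FRationalResolution` (stmt-ResolutionOfSingularities-15317), line `redirect`,
# stub `stub_diagonalizableQuotientResolution` — the UNIT-EXPONENT chart on `S₀` and its comparison
# with the homogeneous chart on `T = S^{(B)}` (brick W3' of memo MEMO-15317-leafhand2-g4 §2bis)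

`S` graded by `A` (pieces `S_a`), `f : A → A'` with the coarsened grading `S'` (`S_a ⊆ S'_{f a}`),
`ι : S₀ = S_0 ↪ T = S'_0`. Data: `A`-homogeneous `x₁,…,x_n` of degrees `aᵢ` with the chart
`φ(m) = x^m` on `P = {m ≥ 0 : Σ mᵢ f(aᵢ) = 0}` into `T` (`…CoarseChartLogRegularNhd`), and
homogeneous UNITS `u₁,…,u_r` of degrees `bⱼ ∈ ker f`. The unit-exponent chart is
`ψ(m, e) = x^m u^e` on `P₀ = {(m, e) ≥ 0 : Σ mᵢ aᵢ + Σ eⱼ bⱼ = 0 ∈ A}` into `S₀` — a chart of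
the same monomial shape on `n + r` letters. For a prime `𝔮` of `T` and `𝔮₀ = ι⁻¹ 𝔮`:
`ι ψ(m, e) = φ(m) · u^e` with `u^e ∈ T^×`, so (faces) `(m, e) ∈ F_ψ(𝔮₀) ⇔ m ∈ F_φ(𝔮)` and, when
every element of `ker f` is some `bⱼ` (so that every `m ∈ P` lifts to `P₀`), (Kato ideals)
`I_ψ(𝔮₀)·T = I_φ(𝔮)` — the matching hypothesis of the descent `…LogRegularDescent`.

* `linearCombination_append`, `append_nonneg_iff`, `prod_append_pow` — `Fin.append` bookkeeping;
* `exists_monomialChart` — the monomial chart of a homogeneous family into `S₀` exists;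
* `proj_mem` / `exists_lift` — `P₀ → P`, `(m, e) ↦ m`, and its surjectivity;
* `exists_unit_coe_eq` — `u^e` is a unit of `T`; `coe_iota_psi` — `ι ψ(m, e) = φ(m) u^e`;
* **`mem_face_iff`** — faces correspond; **`map_ideal_eq`** — Kato ideals match.

Honest label: bookkeeping brick of the wild non-fixed route (no stub closed). No definitions, no
named facts, no sorry. [cite: Kato1994, Def. (2.1)] [folklore; cite: SGA3, Exp. VIII §4–5]
-/

noncomputable section

-- single-problem summit: the doubled namespace component is forced
set_option linter.dupNamespace false

open DirectSum Literature.AlgebraicGeometry.Resolution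

namespace Summit.ResolutionOfSingularities.ResolutionOfSingularities.Theorems.FRationalResolution.UnitChart

universe u w w'

/-! ## `Fin.append` bookkeeping -/

section Append

variable {M : Type w} [AddCommGroup M] {n r : ℕ}

/-- `Σ_l (m,e)_l (a,b)_l = Σ mᵢ aᵢ + Σ eⱼ bⱼ`. [folklore] -/
theorem linearCombination_append (a : Fin n → M) (b : Fin r → M) (m : Fin n → ℤ)
    (e : Fin r → ℤ) :
    Fintype.linearCombination ℤ (Fin.append a b) (Fin.append m e) =
      Fintype.linearCombination ℤ a m + Fintype.linearCombination ℤ b e := by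
  simp only [Fintype.linearCombination_apply, Fin.sum_univ_add, Fin.append_left, Fin.append_right]

/-- `(m, e) ≥ 0 ⇔ m ≥ 0 ∧ e ≥ 0`. [folklore] -/
theorem append_nonneg_iff {m : Fin n → ℤ} {e : Fin r → ℤ} :
    0 ≤ Fin.append m e ↔ 0 ≤ m ∧ 0 ≤ e := by
  constructor
  · intro h
    refine ⟨fun i => ?_, fun j => ?_⟩
    · simpa [Fin.append_left] using h (Fin.castAdd r i)
    · simpa [Fin.append_right] using h (Fin.natAdd n j)
  · rintro ⟨hm, he⟩ l
    induction l using Fin.addCases with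
    | left i => simpa [Fin.append_left] using hm i
    | right j => simpa [Fin.append_right] using he j

/-- A group homomorphism passes through `Fintype.linearCombination ℤ`. [folklore] -/
theorem map_linearCombination {M' : Type w'} [AddCommGroup M'] (f : M →+ M') (g : Fin n → M)
    (m : Fin n → ℤ) :
    f (Fintype.linearCombination ℤ g m) = Fintype.linearCombination ℤ (fun i => f (g i)) m := by
  simp only [Fintype.linearCombination_apply, map_sum, map_zsmul]

end Append

/-- `(x,u)^{(m,e)} = x^m u^e`. [folklore] -/
theorem prod_append_pow {S : Type u} [CommMonoid S] {n r : ℕ} (x : Fin n → S) (u : Fin r → S)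
    (m : Fin n → ℤ) (e : Fin r → ℤ) :
    ∏ l, Fin.append x u l ^ (Fin.append m e l).toNat =
      (∏ i, x i ^ (m i).toNat) * ∏ j, u j ^ (e j).toNat := by
  rw [Fin.prod_univ_add]
  simp only [Fin.append_left, Fin.append_right]

variable {k : Type u} [Field k] {A : Type w} [DecidableEq A] [AddCommGroup A] {S : Type u}
  [CommRing S] [Algebra k S] (𝒮 : A → Submodule k S) [GradedAlgebra 𝒮]

/-! ## The monomial chart of a homogeneous family -/

/-- **The monomial chart into `S₀`.** For homogeneous `y_l ∈ S_{c_l}` the map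
`v ↦ ∏ y_l^{v_l}` on `{v ≥ 0 : Σ v_l c_l = 0}` is a monoid homomorphism into `S₀`.
[cite: Kato1994, Def. (2.1)] [folklore] -/
theorem exists_monomialChart {N : ℕ} (y : Fin N → S) (c : Fin N → A) (hy : ∀ l, y l ∈ 𝒮 (c l))
    (P : AddSubmonoid (Fin N → ℤ))
    (hP : ∀ v, v ∈ P ↔ 0 ≤ v ∧ Fintype.linearCombination ℤ c v = 0) :
    ∃ ψ : Multiplicative P →* 𝒮 0,
      ∀ p : P, ((ψ (Multiplicative.ofAdd p) : 𝒮 0) : S) = ∏ l, y l ^ ((p : Fin N → ℤ) l).toNat := by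
  have hPnonneg : ∀ p : P, (0 : Fin N → ℤ) ≤ (p : Fin N → ℤ) := fun p => ((hP p).mp p.2).1
  have hPdeg : ∀ p : P, Fintype.linearCombination ℤ c (p : Fin N → ℤ) = 0 :=
    fun p => ((hP p).mp p.2).2
  have hmem : ∀ p : P, ∏ l, y l ^ ((p : Fin N → ℤ) l).toNat ∈ 𝒮 0 := fun p => by
    have h := FixedPointLogRegular.prod_pow_toNat_mem 𝒮 y c hy (p : Fin N → ℤ) (hPnonneg p)
    rwa [hPdeg p] at h
  refine ⟨{ toFun := fun p => ⟨∏ l, y l ^ ((p.toAdd : Fin N → ℤ) l).toNat, hmem p.toAdd⟩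
            map_one' := Subtype.ext (by simp)
            map_mul' := fun p q => Subtype.ext ?_ }, fun p => rfl⟩
  change ∏ l, y l ^ (((p.toAdd : Fin N → ℤ) + (q.toAdd : Fin N → ℤ)) l).toNat =
    (∏ l, y l ^ ((p.toAdd : Fin N → ℤ) l).toNat) * ∏ l, y l ^ ((q.toAdd : Fin N → ℤ) l).toNat
  rw [← Finset.prod_mul_distrib]
  refine Finset.prod_congr rfl fun l _ => ?_
  rw [← pow_add, Pi.add_apply, Int.toNat_add (hPnonneg p.toAdd l) (hPnonneg q.toAdd l)]

/-! ## Comparison of the unit-exponent chart on `S₀` with the chart on `T` -/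

section Compare

variable {A' : Type w'} [DecidableEq A'] [AddCommGroup A'] (f : A →+ A') (𝒮' : A' → Submodule k S)
  [GradedAlgebra 𝒮'] (hle : ∀ a, 𝒮 a ≤ 𝒮' (f a)) (ι : 𝒮 0 →+* 𝒮' 0) (hι : ∀ s, (ι s : S) = s)
  {n r : ℕ} {x : Fin n → S} {a : Fin n → A} {u : Fin r → S} {b : Fin r → A}
  (hu : ∀ j, u j ∈ 𝒮 (b j)) (huu : ∀ j, IsUnit (u j)) (hb : ∀ j, f (b j) = 0)
  (P : AddSubmonoid (Fin n → ℤ))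
  (hP : ∀ m, m ∈ P ↔ 0 ≤ m ∧ Fintype.linearCombination ℤ (fun i => f (a i)) m = 0)
  (P₀ : AddSubmonoid (Fin (n + r) → ℤ))
  (hP₀ : ∀ v, v ∈ P₀ ↔ 0 ≤ v ∧ Fintype.linearCombination ℤ (Fin.append a b) v = 0)
  (φ : Multiplicative P →* 𝒮' 0)
  (hφ : ∀ m : P, ((φ (Multiplicative.ofAdd m) : 𝒮' 0) : S) =
    ∏ i, x i ^ ((m : Fin n → ℤ) i).toNat)
  (ψ : Multiplicative P₀ →* 𝒮 0)
  (hψ : ∀ p : P₀, ((ψ (Multiplicative.ofAdd p) : 𝒮 0) : S) =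
    ∏ l, Fin.append x u l ^ ((p : Fin (n + r) → ℤ) l).toNat)

omit [DecidableEq A] [DecidableEq A'] in
include hb hP hP₀ in
/-- The projection `(m, e) ↦ m` maps `P₀` to `P`. [folklore] -/
theorem proj_mem (p : P₀) : (fun i => (p : Fin (n + r) → ℤ) (Fin.castAdd r i)) ∈ P := by
  obtain ⟨hnn, hlc⟩ := (hP₀ p).mp p.2
  rw [hP]
  refine ⟨fun i => hnn (Fin.castAdd r i), ?_⟩
  have h := congrArg f hlc
  rw [← Fin.append_castAdd_natAdd (f := (p : Fin (n + r) → ℤ)), linearCombination_append, map_add,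
    map_zero, map_linearCombination, map_linearCombination] at h
  have h0 : Fintype.linearCombination ℤ (fun j => f (b j))
      (fun j => (p : Fin (n + r) → ℤ) (Fin.natAdd n j)) = 0 := by
    simp only [Fintype.linearCombination_apply, hb, smul_zero, Finset.sum_const_zero]
  rwa [h0, add_zero] at h

omit [DecidableEq A] [DecidableEq A'] in
include hP hP₀ in
/-- **Lifting**: if every element of `ker f` is some `bⱼ`, every `m ∈ P` is the projection of
`(m, δ_{j₀}) ∈ P₀` for an index `j₀` with `b_{j₀} = −Σ mᵢ aᵢ`. [folklore] -/
theorem exists_lift (hbsurj : ∀ d : A, f d = 0 → ∃ j, b j = d) (m : P) :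
    ∃ (p : P₀) (j₀ : Fin r), (∀ i, (p : Fin (n + r) → ℤ) (Fin.castAdd r i) = (m : Fin n → ℤ) i) ∧
      ∀ j, (p : Fin (n + r) → ℤ) (Fin.natAdd n j) = Pi.single (M := fun _ => ℤ) j₀ 1 j := by
  obtain ⟨hnn, hlc⟩ := (hP m).mp m.2
  have hd : f (-Fintype.linearCombination ℤ a (m : Fin n → ℤ)) = 0 := by
    rw [map_neg, map_linearCombination, hlc, neg_zero]
  obtain ⟨j₀, hj₀⟩ := hbsurj _ hd
  have hmem : Fin.append (m : Fin n → ℤ) (Pi.single (M := fun _ => ℤ) j₀ 1) ∈ P₀ := by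
    rw [hP₀]
    refine ⟨append_nonneg_iff.mpr ⟨hnn, fun j => ?_⟩, ?_⟩
    · by_cases hj : j = j₀
      · subst hj; simp
      · simp [hj]
    · rw [linearCombination_append, Fintype.linearCombination_apply_single, one_smul, hj₀,
        add_neg_cancel]
  exact ⟨⟨_, hmem⟩, j₀, fun i => by simp [Fin.append_left], fun j => by simp [Fin.append_right]⟩

include hle hu huu hb in
/-- `u^e` (`e ≥ 0`) is a unit of `T = S'_0`. [folklore; cite: SGA3, Exp. VIII §4–5] -/
theorem exists_unit_coe_eq (e : Fin r → ℤ) :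
    ∃ w : (𝒮' 0)ˣ, ((w : 𝒮' 0) : S) = ∏ j, u j ^ (e j).toNat := by
  have hu' : ∀ j, u j ∈ 𝒮' 0 := fun j => by
    have h := hle (b j) (hu j)
    rwa [hb j] at h
  have hunit : ∀ j, IsUnit (⟨u j, hu' j⟩ : 𝒮' 0) := fun j => by
    obtain ⟨v, hv⟩ := (huu j).exists_right_inv
    have hvmem : v ∈ 𝒮' 0 := by
      have h := hle (-b j) (HomogeneousUnits.inv_mem_of_isUnit 𝒮 (hu j) hv)
      rwa [map_neg, hb j, neg_zero] at h
    exact IsUnit.of_mul_eq_one ⟨v, hvmem⟩ (Subtype.ext (by simpa using hv))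
  have hU : IsUnit (∏ j, (⟨u j, hu' j⟩ : 𝒮' 0) ^ (e j).toNat) :=
    Finset.prod_induction _ IsUnit (fun _ _ => IsUnit.mul) isUnit_one
      (fun j _ => (hunit j).pow _)
  refine ⟨hU.unit, ?_⟩
  rw [IsUnit.unit_spec]
  change algebraMap (𝒮' 0) S (∏ j, (⟨u j, hu' j⟩ : 𝒮' 0) ^ (e j).toNat) = _
  rw [map_prod]
  exact Finset.prod_congr rfl fun j _ => by rw [map_pow]; rfl

include hι hφ hψ in
/-- **`ι ψ(m, e) = φ(m) · u^e`** in `S`. [folklore] -/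
theorem coe_iota_psi (p : P₀) (m : P)
    (hm : ∀ i, (p : Fin (n + r) → ℤ) (Fin.castAdd r i) = (m : Fin n → ℤ) i) :
    ((ι (ψ (Multiplicative.ofAdd p)) : 𝒮' 0) : S) =
      ((φ (Multiplicative.ofAdd m) : 𝒮' 0) : S) *
        ∏ j, u j ^ ((p : Fin (n + r) → ℤ) (Fin.natAdd n j)).toNat := by
  rw [hι, hψ, hφ]
  conv_lhs => rw [← Fin.append_castAdd_natAdd (f := (p : Fin (n + r) → ℤ))]
  rw [prod_append_pow]
  congr 2
  funext i
  rw [hm i]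

include hle hι hu huu hb hφ hψ in
/-- **Faces correspond**: `(m, e) ∈ F_ψ(ι⁻¹𝔮) ⇔ m ∈ F_φ(𝔮)`. [cite: Kato1994, Def. (2.1)] -/
theorem mem_face_iff (𝔮 : Ideal (𝒮' 0)) [𝔮.IsPrime] (p : P₀) (m : P)
    (hm : ∀ i, (p : Fin (n + r) → ℤ) (Fin.castAdd r i) = (m : Fin n → ℤ) i) :
    p ∈ LogChart.face P₀ ψ (𝔮.comap ι) ↔ m ∈ LogChart.face P φ 𝔮 := by
  obtain ⟨w, hw⟩ := exists_unit_coe_eq 𝒮 f 𝒮' hle hu huu hb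
    (fun j => (p : Fin (n + r) → ℤ) (Fin.natAdd n j))
  have heq : ι (ψ (Multiplicative.ofAdd p)) = φ (Multiplicative.ofAdd m) * (w : 𝒮' 0) :=
    Subtype.ext (by
      rw [show ((φ (Multiplicative.ofAdd m) * (w : 𝒮' 0) : 𝒮' 0) : S) =
          ((φ (Multiplicative.ofAdd m) : 𝒮' 0) : S) * ((w : 𝒮' 0) : S) from rfl, hw,
        coe_iota_psi 𝒮 𝒮' ι hι P P₀ φ hφ ψ hψ p m hm])
  rw [LogChart.mem_face_iff, LogChart.mem_face_iff, Ideal.mem_comap, heq,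
    Ideal.mul_unit_mem_iff_mem 𝔮 w.isUnit]

include hle hι hu huu hb hP hP₀ hφ hψ in
/-- **Kato ideals match**: `I_ψ(ι⁻¹𝔮)·T = I_φ(𝔮)` when every element of `ker f` is some `bⱼ`.
[cite: Kato1994, Def. (2.1)] -/
theorem map_ideal_eq (hbsurj : ∀ d : A, f d = 0 → ∃ j, b j = d) (𝔮 : Ideal (𝒮' 0))
    [𝔮.IsPrime] :
    (LogChart.ideal P₀ ψ (𝔮.comap ι)).map ι = LogChart.ideal P φ 𝔮 := by
  apply le_antisymm
  · rw [Ideal.map_le_iff_le_comap, LogChart.ideal, Ideal.span_le]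
    rintro _ ⟨p, hp, rfl⟩
    have hp' : ι (ψ (Multiplicative.ofAdd p)) ∈ 𝔮 := hp
    let m : P := ⟨_, proj_mem f hb P hP P₀ hP₀ p⟩
    obtain ⟨w, hw⟩ := exists_unit_coe_eq 𝒮 f 𝒮' hle hu huu hb
      (fun j => (p : Fin (n + r) → ℤ) (Fin.natAdd n j))
    have heq : ι (ψ (Multiplicative.ofAdd p)) = φ (Multiplicative.ofAdd m) * (w : 𝒮' 0) :=
      Subtype.ext (by
        rw [show ((φ (Multiplicative.ofAdd m) * (w : 𝒮' 0) : 𝒮' 0) : S) =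
            ((φ (Multiplicative.ofAdd m) : 𝒮' 0) : S) * ((w : 𝒮' 0) : S) from rfl, hw,
          coe_iota_psi 𝒮 𝒮' ι hι P P₀ φ hφ ψ hψ p m (fun i => rfl)])
    change ι (ψ (Multiplicative.ofAdd p)) ∈ LogChart.ideal P φ 𝔮
    rw [heq]
    rw [heq, Ideal.mul_unit_mem_iff_mem 𝔮 w.isUnit] at hp'
    exact Ideal.mul_mem_right _ _ (Ideal.subset_span ⟨m, hp', rfl⟩)
  · rw [LogChart.ideal, Ideal.span_le]
    rintro _ ⟨m, hmq, rfl⟩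
    have hmq' : φ (Multiplicative.ofAdd m) ∈ 𝔮 := hmq
    obtain ⟨p, j₀, hpm, hpe⟩ := exists_lift f P hP P₀ hP₀ hbsurj m
    obtain ⟨w, hw⟩ := exists_unit_coe_eq 𝒮 f 𝒮' hle hu huu hb
      (fun j => (p : Fin (n + r) → ℤ) (Fin.natAdd n j))
    have heq : ι (ψ (Multiplicative.ofAdd p)) = φ (Multiplicative.ofAdd m) * (w : 𝒮' 0) :=
      Subtype.ext (by
        rw [show ((φ (Multiplicative.ofAdd m) * (w : 𝒮' 0) : 𝒮' 0) : S) =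
            ((φ (Multiplicative.ofAdd m) : 𝒮' 0) : S) * ((w : 𝒮' 0) : S) from rfl, hw,
          coe_iota_psi 𝒮 𝒮' ι hι P P₀ φ hφ ψ hψ p m hpm])
    have hpq : ψ (Multiplicative.ofAdd p) ∈ 𝔮.comap ι := by
      rw [Ideal.mem_comap, heq]
      exact Ideal.mul_mem_right _ _ hmq'
    have hmem : ψ (Multiplicative.ofAdd p) ∈ LogChart.ideal P₀ ψ (𝔮.comap ι) :=
      Ideal.subset_span ⟨p, hpq, rfl⟩
    have hφeq : φ (Multiplicative.ofAdd m) = ι (ψ (Multiplicative.ofAdd p)) * (↑w⁻¹ : 𝒮' 0) := by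
      rw [heq, mul_assoc, Units.mul_inv, mul_one]
    change φ (Multiplicative.ofAdd m) ∈ (LogChart.ideal P₀ ψ (𝔮.comap ι)).map ι
    rw [hφeq]
    exact Ideal.mul_mem_right _ _ (Ideal.mem_map_of_mem ι hmem)

end Compare

end Summit.ResolutionOfSingularities.ResolutionOfSingularities.Theorems.FRationalResolution.UnitChart

end
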